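import Mathlib.AlgebraicGeometry.Morphisms.Etale
import Mathlib.AlgebraicGeometry.Morphisms.FormallyUnramified
import Mathlib.RingTheory.LocalRing.ResidueField.Basic
import Literature.RingTheory.Henselian.EtaleSectionsFactorization
import Literature.AlgebraicGeometry.Morphisms.AffinePointsOverSpec
import HarnessLib

/-!
# Sections of étale morphisms over a henselian local base: uniqueness (unramified diagonal) and existence (Hensel)
# ([StacksProject 04GG (8), 02GE, 024T]; [EGAIV4] 17.4.2, 18.5.17; [BLRNeronModels1990] §2.3 Prop. 5)

Topic `Literature/AlgebraicGeometry/Morphisms`; namespace `Literature.AlgebraicGeometry.Morphisms`.  PROOF FILE (theorems only; no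
definition, no named fact, no instance, no `sorry`).  Cell `hodgecm-mathlib` (D-0151), FLOOR 0, programme F0P5a (D9op road 2′, crux item
stmt-HodgeConjecture-24832), (γ3-GENERIC) row **Γ3-E1** of the desk `F0/P5a/Gamma3-DESK.v0.1.F0P5a-plan-g2.lean` (`FibreCountOneOfEtaleNear`):
the SCHEME-LEVEL half «an `R`-point of the base under an étale neighbourhood of a rational point of the special fibre lifts to EXACTLY ONE
`R`-point through that rational point», for `R` a henselian local ring.  The D1 reading (integral models, reduction map) is the sequel
`Motives/IntegralModelFibreCountEtale.lean`.

* §1 UNIQUENESS `eq_of_formallyUnramified_of_comp_eq` — for `w : V ⟶ S` formally unramified and locally of finite type, two morphisms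
  `σ₁ σ₂ : Spec R ⟶ V` (`R` LOCAL) over the same `S`-point which agree after composition with some `c : C ⟶ Spec R` hitting the closed
  point are EQUAL.  Proof: the diagonal `Δ : V ⟶ V ×_S V` is an OPEN IMMERSION ([StacksProject 02GE], Mathlib
  `AlgebraicGeometry.FormallyUnramified.isOpenImmersion_diagonal`); `(σ₁, σ₂) : Spec R ⟶ V ×_S V` sends the closed point into `Δ(V)`, hence
  (every point of `Spec R` specialises to the closed point and `Δ(V)` is open) all of `Spec R`, so `(σ₁, σ₂)` factors through `Δ`
  (Mathlib `IsOpenImmersion.lift`).  No separatedness is needed.  Corollary `eq_of_formallyUnramified_of_residue_comp_eq` (agreement on the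
  residue field `Spec κ(R) → Spec R`).  [EGAIV4] 17.4.2 / [StacksProject 024T] state this for sections of unramified separated morphisms
  over a connected base; over a LOCAL base the open half of the diagonal suffices.
* §2 EXISTENCE `exists_section_of_etale` — for `R` a HENSELIAN local ring and `g : V ⟶ Spec R` ÉTALE, every `κ(R)`-point `q` of `V` over
  the closed point is the specialisation of a SECTION `s` of `g` (`s ≫ g = 𝟙`, `Spec κ(R) → Spec R ≫ s = q`): on an affine open `W ∋ q`
  the étale `R`-algebra `Γ(W)` ([StacksProject 02GU]; Mathlib `HasRingHomProperty @Etale RingHom.Etale`) has a `κ(R)`-point, which lifts to an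
  `R`-point by ★ `Literature.RingTheory.Henselian.exists_algHom_of_etale` ([StacksProject 04GG (1) ⇒ (8)], B-p15), read back as a morphism
  `Spec R ⟶ W` by ★ `Morphisms.comp_eq_specMap_iff` / `appTop_specMap_comp_isoSpec_inv_comp_ΓSpecIso_hom` ([StacksProject 01I1], B-p15).
* §3 `existsUnique_section_of_etale`, `existsUnique_lift_of_etale` — the two combined: exactly ONE section through `q`; and the RELATIVE
  form consumed by the D1 sequel: for `w : V ⟶ S` étale, an `R`-point `x̃ : Spec R ⟶ S` and a `κ(R)`-point `q` of `V` over `x̃`, there is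
  exactly one `ρ : Spec R ⟶ V` over `x̃` specialising to `q` ([EGAIV4] 18.5.17; [BLRNeronModels1990] §2.3 Prop. 5 for smooth `w`,
  existence only).

HC_CM is proved only modulo the 7 printed citations until rung 0 closes; this file is generic scheme theory and changes no count.

## References
* [StacksProject] The Stacks Project: Tag 04GG (Algebra, Lemma 10.153.3 (8): henselian ⇔ pointed sections of étale algebras), Tag 02GE
  (Morphisms, Lemma 29.35.13: unramified ⇒ diagonal an open immersion), Tag 024T (Étale morphisms, sections), Tag 02GU (étale = flat +
  unramified + lfp), Tag 01I1 (morphisms into affine schemes).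
* [EGAIV4] A. Grothendieck, J. Dieudonné, *ÉGA IV₄*, Publ. Math. IHÉS 32 (1967): Cor. 17.4.2, Prop. 18.5.17.
* [BLRNeronModels1990] S. Bosch, W. Lütkebohmert, M. Raynaud, *Néron Models*, Springer 1990, §2.3 Prop. 5.
-/

set_option autoImplicit false

noncomputable section

universe u

open CategoryTheory CategoryTheory.Limits AlgebraicGeometry IsLocalRing

namespace Literature.AlgebraicGeometry.Morphisms

/-! ### §1 Uniqueness: two `R`-points through an unramified neighbourhood agreeing at the closed point are equal -/

section Uniqueness

variable {V S : Scheme.{u}} (w : V ⟶ S) [FormallyUnramified w] [LocallyOfFiniteType w]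
variable {R : Type u} [CommRing R] [IsLocalRing R]

/-- **Uniqueness of lifts through an unramified morphism over a local base.**  Let `w : V ⟶ S` be formally unramified and locally of
finite type, `R` a local ring, and `σ₁ σ₂ : Spec R ⟶ V` with `σ₁ ≫ w = σ₂ ≫ w`.  If `c ≫ σ₁ = c ≫ σ₂` for some `c : C ⟶ Spec R` whose image
contains the closed point, then `σ₁ = σ₂`.  (The diagonal of `w` is an open immersion, [StacksProject 02GE]; `(σ₁, σ₂)` meets it at the closed
point, to which every point of `Spec R` specialises.) [cite: StacksProject, Tag 02GE] [cite: EGAIV4, Cor. 17.4.2] -/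
theorem eq_of_formallyUnramified_of_comp_eq (σ₁ σ₂ : Spec (.of R) ⟶ V) (hw : σ₁ ≫ w = σ₂ ≫ w)
    {C : Scheme.{u}} (c : C ⟶ Spec (.of R)) (hc0 : closedPoint R ∈ Set.range c) (hc : c ≫ σ₁ = c ≫ σ₂) : σ₁ = σ₂ := by
  -- the pair `(σ₁, σ₂)` and the diagonal
  let t : Spec (.of R) ⟶ pullback w w := pullback.lift σ₁ σ₂ hw
  let δ : V ⟶ pullback w w := pullback.diagonal w
  have hct : c ≫ t = (c ≫ σ₁) ≫ δ := by
    refine pullback.hom_ext ?_ ?_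
    · rw [Category.assoc, pullback.lift_fst, Category.assoc, Category.assoc, pullback.diagonal_fst, Category.comp_id]
    · rw [Category.assoc, pullback.lift_snd, Category.assoc, Category.assoc, pullback.diagonal_snd, Category.comp_id, hc]
  -- the closed point lands in the (open) image of the diagonal
  have h0 : t (closedPoint R) ∈ Set.range δ := by
    obtain ⟨p, hp⟩ := hc0
    refine ⟨(c ≫ σ₁) p, ?_⟩
    rw [← hp, ← Scheme.Hom.comp_apply, ← Scheme.Hom.comp_apply, hct]
  -- hence every point does
  have hrange : Set.range t ⊆ Set.range δ := by
    rintro _ ⟨p, rfl⟩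
    have hsp : t p ⤳ t (closedPoint R) := (specializes_closedPoint p).map t.continuous
    exact hsp.mem_open (IsOpenImmersion.isOpen_range δ) h0
  -- factor through the diagonal
  obtain ⟨l, hl⟩ : ∃ l : Spec (.of R) ⟶ V, l ≫ δ = t := ⟨_, IsOpenImmersion.lift_fac δ t hrange⟩
  calc σ₁ = t ≫ pullback.fst w w := (pullback.lift_fst σ₁ σ₂ hw).symm
    _ = l := by rw [← hl, Category.assoc, pullback.diagonal_fst, Category.comp_id]
    _ = t ≫ pullback.snd w w := by rw [← hl, Category.assoc, pullback.diagonal_snd, Category.comp_id]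
    _ = σ₂ := pullback.lift_snd σ₁ σ₂ hw

/-- The residue field of a local ring hits the closed point: `Spec κ(R) → Spec R` has the closed point in its image. [folklore] -/
private theorem closedPoint_mem_range_specMap_residue :
    closedPoint R ∈ Set.range (Spec.map (CommRingCat.ofHom (residue R))) :=
  ⟨closedPoint (ResidueField R), by rw [Spec.map_apply]; exact comap_closedPoint (residue R)⟩

/-- **Uniqueness of lifts agreeing on the residue field**: for `w : V ⟶ S` formally unramified and locally of finite type over a local
ring `R`, two `σ₁ σ₂ : Spec R ⟶ V` over the same `S`-point with `Spec κ(R) → Spec R ≫ σ₁ = Spec κ(R) → Spec R ≫ σ₂` are equal.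
[cite: StacksProject, Tag 02GE] [cite: EGAIV4, Cor. 17.4.2] -/
theorem eq_of_formallyUnramified_of_residue_comp_eq (σ₁ σ₂ : Spec (.of R) ⟶ V) (hw : σ₁ ≫ w = σ₂ ≫ w)
    (h0 : Spec.map (CommRingCat.ofHom (residue R)) ≫ σ₁ = Spec.map (CommRingCat.ofHom (residue R)) ≫ σ₂) : σ₁ = σ₂ :=
  eq_of_formallyUnramified_of_comp_eq w σ₁ σ₂ hw _ closedPoint_mem_range_specMap_residue h0

end Uniqueness

/-! ### §2 Existence: henselian sections of étale morphisms -/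

section Existence

variable {R : Type u} [CommRing R] [HenselianLocalRing R]

omit [HenselianLocalRing R] in
/-- For an affine `P` and an ÉTALE `g : P ⟶ Spec R`, the structure map `φ_g := (ΓSpecIso R)⁻¹ ≫ g.appTop : R ⟶ Γ(P, ⊤)` is an étale ring map
(`Etale` is affine-locally `RingHom.Etale`, [StacksProject 02GU]; both ends affine). [cite: StacksProject, Tag 02GU] -/
theorem etale_ΓSpecIso_inv_comp_appTop {P : Scheme.{u}} [IsAffine P] (g : P ⟶ Spec (.of R)) [Etale g] :
    ((Scheme.ΓSpecIso (.of R)).inv ≫ g.appTop).hom.Etale := by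
  have h1 : g.appTop.hom.Etale := HasRingHomProperty.appTop (P := @Etale) g inferInstance
  have h2 : (Scheme.ΓSpecIso (.of R)).inv.hom.Etale :=
    RingHom.Etale.of_bijective (Scheme.ΓSpecIso (CommRingCat.of R)).symm.commRingCatIsoToRingEquiv.bijective
  rw [CommRingCat.hom_comp]
  exact RingHom.Etale.stableUnderComposition _ _ h2 h1

/-- **Henselian sections, affine case**: for `R` a henselian local ring, `P` affine and `g : P ⟶ Spec R` étale, every `κ(R)`-point
`q : Spec κ(R) ⟶ P` over the closed point (`q ≫ g = Spec (R → κ(R))`) extends to a SECTION `s : Spec R ⟶ P` of `g` with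
`Spec κ(R) → Spec R ≫ s = q`.  The `κ(R)`-point is a `κ(R)`-valued `R`-algebra map on the étale `R`-algebra `Γ(P, ⊤)` ([StacksProject 01I1]),
which lifts to an `R`-valued one by [StacksProject 04GG (1) ⇒ (8)] (★ `Literature.RingTheory.Henselian.exists_algHom_of_etale`).
[cite: StacksProject, Tag 04GG] [cite: StacksProject, Tag 01I1] -/
theorem exists_section_of_etale_of_isAffine {P : Scheme.{u}} [IsAffine P] (g : P ⟶ Spec (.of R)) [Etale g]
    (q : Spec (.of (ResidueField R)) ⟶ P) (hq : q ≫ g = Spec.map (CommRingCat.ofHom (residue R))) :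
    ∃ s : Spec (.of R) ⟶ P, s ≫ g = 𝟙 _ ∧ Spec.map (CommRingCat.ofHom (residue R)) ≫ s = q := by
  -- the étale `R`-algebra `Γ(P, ⊤)`
  let φ₀ : CommRingCat.of R ⟶ Γ(P, ⊤) := (Scheme.ΓSpecIso (.of R)).inv ≫ g.appTop
  letI : Algebra R Γ(P, ⊤) := φ₀.hom.toAlgebra
  haveI : Algebra.Etale R Γ(P, ⊤) := etale_ΓSpecIso_inv_comp_appTop g
  -- the `κ(R)`-point as an `R`-algebra map
  let ψ₀ : Γ(P, ⊤) ⟶ CommRingCat.of (ResidueField R) := q.appTop ≫ (Scheme.ΓSpecIso (.of (ResidueField R))).hom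
  have hψ₀ : φ₀ ≫ ψ₀ = CommRingCat.ofHom (residue R) := by
    have h := (comp_eq_specMap_iff g (CommRingCat.ofHom (residue R)) q).1 hq
    rw [← Category.assoc] at h
    exact h
  let φ : Γ(P, ⊤) →ₐ[R] ResidueField R :=
    { ψ₀.hom with
      commutes' := fun r => by
        change ψ₀.hom (φ₀.hom r) = residue R r
        rw [← CommRingCat.comp_apply, hψ₀]
        rfl }
  -- Hensel: an `R`-valued point lifting `φ`
  obtain ⟨τ, hτ⟩ := Literature.RingTheory.Henselian.exists_algHom_of_etale (R := R) (A := Γ(P, ⊤)) (K := ResidueField R)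
    residue_surjective φ
  let ψ₁ : Γ(P, ⊤) ⟶ CommRingCat.of R := CommRingCat.ofHom τ.toRingHom
  have hψ₁ : φ₀ ≫ ψ₁ = 𝟙 _ := by
    ext r
    exact τ.commutes r
  have hψ₁₀ : ψ₁ ≫ CommRingCat.ofHom (residue R) = ψ₀ := by
    ext y
    exact hτ y
  -- the section
  refine ⟨Spec.map ψ₁ ≫ P.isoSpec.inv, ?_, ?_⟩
  · have h := (comp_eq_specMap_iff g (𝟙 (CommRingCat.of R)) (Spec.map ψ₁ ≫ P.isoSpec.inv)).2 (by
      rw [appTop_specMap_comp_isoSpec_inv_comp_ΓSpecIso_hom, ← Category.assoc]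
      exact hψ₁)
    rwa [Spec.map_id] at h
  · apply bijective_appTop_comp_ΓSpecIso_hom.1
    change (Spec.map (CommRingCat.ofHom (residue R)) ≫ Spec.map ψ₁ ≫ P.isoSpec.inv).appTop ≫
        (Scheme.ΓSpecIso (.of (ResidueField R))).hom = q.appTop ≫ (Scheme.ΓSpecIso (.of (ResidueField R))).hom
    rw [Scheme.Hom.comp_appTop, Category.assoc, Scheme.ΓSpecIso_naturality, ← Category.assoc,
      appTop_specMap_comp_isoSpec_inv_comp_ΓSpecIso_hom, hψ₁₀]

/-- **Henselian sections of étale morphisms** ([StacksProject 04GG (8)] in scheme form; [BLRNeronModels1990] §2.3 Prop. 5): for `R` a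
henselian local ring and `g : V ⟶ Spec R` ÉTALE, every `κ(R)`-point `q` of `V` over the closed point extends to a section `s` of `g` with
`Spec κ(R) → Spec R ≫ s = q` (reduce to an affine open neighbourhood of the image of `q`).
[cite: StacksProject, Tag 04GG] [cite: BLRNeronModels1990, §2.3 Prop. 5] -/
theorem exists_section_of_etale {V : Scheme.{u}} (g : V ⟶ Spec (.of R)) [Etale g]
    (q : Spec (.of (ResidueField R)) ⟶ V) (hq : q ≫ g = Spec.map (CommRingCat.ofHom (residue R))) :
    ∃ s : Spec (.of R) ⟶ V, s ≫ g = 𝟙 _ ∧ Spec.map (CommRingCat.ofHom (residue R)) ≫ s = q := by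
  -- an affine open around the image of the point
  obtain ⟨_, ⟨W', hW, rfl⟩, hv₀, -⟩ :=
    V.isBasis_affineOpens.exists_subset_of_mem_open (Set.mem_univ (q (closedPoint (ResidueField R)))) isOpen_univ
  let W : V.Opens := W'
  haveI : IsAffine W := hW
  -- `q` factors through `W`
  have hqW : Set.range q ⊆ Set.range W.ι := by
    rintro _ ⟨p, rfl⟩
    obtain rfl : p = closedPoint (ResidueField R) := Subsingleton.elim _ _
    rw [Scheme.Opens.range_ι]
    exact hv₀
  obtain ⟨q', hq'⟩ : ∃ q' : Spec (.of (ResidueField R)) ⟶ W, q' ≫ W.ι = q := ⟨_, IsOpenImmersion.lift_fac W.ι q hqW⟩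
  obtain ⟨s', hs'g, hs'q⟩ := exists_section_of_etale_of_isAffine (W.ι ≫ g) q' (by rw [← Category.assoc, hq', hq])
  exact ⟨s' ≫ W.ι, by rw [Category.assoc, hs'g], by rw [← Category.assoc, hs'q, hq']⟩

end Existence

/-! ### §3 Exactly one lift -/

section ExistsUnique

variable {R : Type u} [CommRing R] [HenselianLocalRing R]

/-- **Exactly one section through a rational point of the special fibre** of an étale `g : V ⟶ Spec R` over a henselian local `R`.
[cite: StacksProject, Tag 04GG] [cite: EGAIV4, Prop. 18.5.17] -/
theorem existsUnique_section_of_etale {V : Scheme.{u}} (g : V ⟶ Spec (.of R)) [Etale g]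
    (q : Spec (.of (ResidueField R)) ⟶ V) (hq : q ≫ g = Spec.map (CommRingCat.ofHom (residue R))) :
    ∃! s : Spec (.of R) ⟶ V, s ≫ g = 𝟙 _ ∧ Spec.map (CommRingCat.ofHom (residue R)) ≫ s = q := by
  obtain ⟨s, hs, hsq⟩ := exists_section_of_etale g q hq
  refine ⟨s, ⟨hs, hsq⟩, fun s' hs' => ?_⟩
  exact eq_of_formallyUnramified_of_residue_comp_eq g s' s (by rw [hs'.1, hs]) (by rw [hs'.2, hsq])

/-- **Exactly one lift over a given `R`-point** (the relative form): for `w : V ⟶ S` ÉTALE, `R` henselian local, `x̃ : Spec R ⟶ S` and a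
`κ(R)`-point `q` of `V` with `q ≫ w = Spec κ(R) → Spec R ≫ x̃`, there is EXACTLY ONE `ρ : Spec R ⟶ V` with `ρ ≫ w = x̃` and
`Spec κ(R) → Spec R ≫ ρ = q` (base change of `w` along `x̃` is étale over `Spec R`; §2 + §1).
[cite: EGAIV4, Prop. 18.5.17] [cite: StacksProject, Tag 04GG] [cite: BLRNeronModels1990, §2.3 Prop. 5] -/
theorem existsUnique_lift_of_etale {V S : Scheme.{u}} (w : V ⟶ S) [Etale w] (xt : Spec (.of R) ⟶ S)
    (q : Spec (.of (ResidueField R)) ⟶ V) (hq : q ≫ w = Spec.map (CommRingCat.ofHom (residue R)) ≫ xt) :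
    ∃! ρ : Spec (.of R) ⟶ V, ρ ≫ w = xt ∧ Spec.map (CommRingCat.ofHom (residue R)) ≫ ρ = q := by
  -- existence through the base change `V ×_S Spec R → Spec R`
  obtain ⟨s, hs, hsq⟩ := exists_section_of_etale (pullback.snd w xt)
    (pullback.lift q (Spec.map (CommRingCat.ofHom (residue R))) hq) (pullback.lift_snd _ _ _)
  refine ⟨s ≫ pullback.fst w xt, ⟨?_, ?_⟩, fun ρ hρ => ?_⟩
  · rw [Category.assoc, pullback.condition, ← Category.assoc, hs, Category.id_comp]
  · rw [← Category.assoc, hsq, pullback.lift_fst]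
  · exact eq_of_formallyUnramified_of_residue_comp_eq w ρ (s ≫ pullback.fst w xt)
      (by rw [hρ.1, Category.assoc, pullback.condition, ← Category.assoc, hs, Category.id_comp])
      (by rw [hρ.2, ← Category.assoc, hsq, pullback.lift_fst])

end ExistsUnique

end Literature.AlgebraicGeometry.Morphisms

end
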